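/-
COR-CM (cells pub-hodgecm / pub-hodgecm2, stage 2 of the Hodge ladder) — TRANSPOSITION SURGE, item (vi) sub-binder S2 / (vi-2)
`supply`, PINNING RECORD, REACH HALF: TEAM hComp sub-object **(U2) «honest `PropC5Data` instantiation under package P2′»**
(pin-1's HCOMP-ANATOMY v1.2 §1 (U2); s2crux-idea-1's REVIEW-CHECKLIST-U2-HonestP5.md rows U2-1…U2-8).  Seat
prover-pub-hodgecm2-b25-g38-0 (binder seat b25, gen 38; acting `hcomp-level` / `hcomp-compare-1` until those seats are minted;
claim HCOMP-U2, HOME/lit/LIT-STATUS.md + HOME/LIT-CLAIMS.md 2026-08-21T19:08Z, HOME/INBOX.md l.4966; path under the stage-2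
lead's team staging of 2026-08-21T18:45:07Z (1): `Transposition/HComp/<Name>.lean`).  DEFINITIONS + their unfolding lemmas:
no named fact, no `variable (h : …)`, nothing asserted, no proof holes; the canonical-model system enters as a PARAMETER
`M : C5.SmallLevel K₀ ⥤ SchemeOver F` (x1's `UnitaryCanonicalModel.RecordSystem … |>.M`, p300116), so this file has NO
hypothesis binder (T5: n/a).  Nothing in the tree is edited or restated.  FRAMING: HC_CM is NOT proved; S2 is NOT closed;
this is a SUB-OBJECT (a carrier instantiation), not a discharge.
-/
import Literature.NumberTheory.Automorphic.Liu2021.AppendixC.Glue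
import Literature.AlgebraicGeometry.Motives.FiberBaseChange
import Literature.AlgebraicGeometry.Motives.BaseChangeProofs
import Summits.HodgeConjecture.CorCM.CM.Basic
import HarnessLib

/-!
# TEAM hComp (U2): the honest Prop-C.5 datum `P5` of the tree's hermitian space `V`, and Prop. C.5 CONSTRUCTED on it

Pin-1's REACH binders (`hUnif` / `hTree`, `Transposition/Item6PinReachGlue.lean` :171–182, `Item6PinReachAlong.lean` v2 :302–311)
are typed over a CONSUMER CARRIER `P5 F ι₁ V Φ : Liu2021.AppendixC.PropC5Data (maximalRealSubfield F) F` ([Liu2021] App. C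
l. 4618–4624: the rank `n`, `𝕍`, `𝔾(𝔸_F^∞)`, the nearby spaces `V(τ)`, the groups `G(τ)(𝔸^∞)`, the FIXED isomorphisms
`𝔾(𝔸_F^∞) ≃ G(τ)(𝔸^∞)`, and the projective systems `K ↦ Sh(G(τ), h_{V(τ),τ'})_K` over `τ'(E)`) and over `C : Sec42Data (P5 …) …`
(§4.2: Liu's `Sh(𝕍)_K`, `X_K`, `A_K`), whose field `C.S : IncoherentShimuraSystem (P5 …)` carries Prop. C.5's isomorphisms as
DATA.  For `hUnif`/`hTree` to be PROVABLE (pin-1's (U5)), the slot of `P5.Sh` that the kernel reads — `τ = τ₁` the real place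
under `ι₁`, `τ' = e ι₁`; under package P2′ `e ι₁ = ῑ₁ := conj ∘ ι₁` — must BE the canonical model whose complex points are the
tree's ball quotients (s2crux-idea-1 ROUTES §8.8–8.12; x1's record `UnitaryCanonicalModel.RecordSystem F V.Hm ι₁ T hT K₀`,
`Literature/AlgebraicGeometry/ShimuraVarieties/UnitaryShimuraCanonicalModel.lean`, p300116: the canonical models `M_K`,
`K ≤ K₀` open compact in `U(V)(𝔸_{F⁺,f})`, of `Sh(Res_{F⁺/ℚ} U(V), h_{V,ῑ₁})_K`, regarded over `F` along `ι₁`, complex points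
`= Sh_K(ℂ)` on the TAUTOLOGICAL ball of `V^{ι₁}`).  This file builds that carrier, HONESTLY and UNIFORMLY, from any projective
system `M : C5.SmallLevel K₀ ⥤ SchemeOver F` (the record's `.M`; nothing else of the record is used here):

* §0 (index plumbing, any topological group `H`): `restrictLevel K₀ : K ↦ K ⊓ K₀` as a functor
  `C5.OpenCompactSubgroup H ⥤ C5.SmallLevel K₀`; below `K₀` it undoes `C5.OpenCompactSubgroup.transport (ContinuousMulEquiv.refl H)`
  up to a (unique) isomorphism of the index preorder (`transportRestrictIso`, `restrictTransportIso`).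
* §1 `conjSystem M : K ↦ X_K := M_K ⊗_{F,c} F` (Liu's `X_K = M_K^{(c)}`: [Liu2021] Prop. C.5 puts `Sh(𝕍)_K ⊗_{E,τ'} τ'(E) ≃
  Sh(G(τ), h_{V(τ),τ'})_K` for EVERY `τ'` above `τ`; at `τ' = ῑ₁` Deligne's domain for `h_{V,ῑ₁}` IS the tautological ball at `ι₁`
  ([Liu2021] App. C l. 4583–4596 `h_{V,τ'}(z) = diag(1_{n−1}, z/z̄)`; [Milne2005] (21), Thm. 2.14), so `X_K ⊗_{F,ῑ₁} = M_K ⊗_{F,ι₁}`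
  must be the record: `X_K := M_K ⊗_{F,c} F`, checklist U2-2 — never a transport along `ῑ₁`).
* §2 **`honestP5 V K₀ M : PropC5Data (maximalRealSubfield F) F`** — `n := 3`; `G := Gτ τ := ↥V.adelicFin` for EVERY real `τ`
  (`U(V)(𝔸_{F⁺,f})`, the tree's `UnitaryGroup.finAdelic`; Liu FIXES isomorphisms `𝔾(𝔸_F^∞) ≃ G(τ)(𝔸^∞)`, l. 4624 — all these
  groups are isomorphic and we may fix identities), `fix τ := ContinuousMulEquiv.refl _` (U2-4); ⟨CARRIER⟩ tokens `𝕍 := Fin 3 →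
  𝔸_F` and `V τ := Fin 3 → F` (underlying modules only; the forms are not part of a `Type`); and ONE formula for ALL slots
  (U2-1): `Sh τ τ' := restrictLevel K₀ ⋙ conjSystem M ⋙ C5.baseChangeAlong τ'.rangeRestrictField`, i.e.
  `K ↦ X_{K ⊓ K₀} ⊗_{F,τ'} τ'(F)` — functorial through the record functor, no per-slot case split, no choice per `K`.
  (W-τ) HONESTY (U2-5): `PropC5Data.Sh` is a ⟨CARRIER⟩ field for ALL `(τ, τ')` (PropC5.lean :330, READING R2); Prop. C.5 (a
  theorem in print, [Liu2021] l. 4627–4633, proof «[Gro, §10]») says the slot `(τ, τ')` IS `Sh(𝕍)_K ⊗_{E,τ'} τ'(E)` up to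
  isomorphism; we CONSTRUCT every slot as that base change and CERTIFY only the consumed one, `(τ₁, ῑ₁)`, through the record
  (§4); the slots `τ ≠ τ₁` (Shimura varieties of the NEARBY spaces `V(τ)`, signature `(2,1)` at `τ`, `(3,0)` elsewhere — not
  constructed here, no `V(τ)`, no Landherr) and the slot `(τ₁, ι₁)` (the CONJUGATE ball, V-cplx) are honest by unconsumption
  (U2-7: nowhere does this file put natural-level pieces in the `ι₁` slot).
* §3 **Prop. C.5 CONSTRUCTED, not posited** (U2-3): `honestSystem V K₀ M : IncoherentShimuraSystem (honestP5 V K₀ M)` with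
  threshold `K₀` (U2-6: pin-1's `Ksm := K₀`; «sufficiently small» is MET by the record's hypothesis on `K₀`, e.g. `K₀ ≤ K_f(3)`),
  `Sh𝕍 := conjSystem M` and the printed isomorphisms of projective systems given by the IDENTITY of `X_K ⊗_{F,τ'} τ'(F)` composed
  with the index isomorphism of §0 (unitor / whiskering / associator) — so a consumer's `(C …).S` can be THIS system and
  `PropC5AsPrinted (honestP5 …)` holds by construction (`propC5AsPrinted_honestP5`); the printed attributes «smooth of dimension
  `n − 1 = 2`», «projective» of `Sh(𝕍)_K = X_K` follow from those of `M_K` (the record's (F1)) by base change (Liu 2002 Prop.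
  3.1.23 / 4.3.38: tree `IsProjectiveOver.baseChange_obj`, Mathlib `smoothOfRelativeDimension_isStableUnderBaseChange`) —
  `smooth_conjSystem_obj`, `projective_conjSystem_obj` (the `CompactifiedSystem` of Def. C.8, Compact Case «`S̃h(𝕍)_K = Sh(𝕍)_K`»,
  l. 4656, is assembled from them at the record in the sequel file, hypothesis-free).
* §4 the LEVELWISE READING pin-1's (U5) consumes BY NAME: for `K ≤ K₀`,
  `honestP5_Sh_transport_obj_iso : (honestP5 …).Sh τ τ' .obj (transport (fix τ) K) ≅ X_K ⊗_{F,τ'} τ'(F)` and, over `ℂ`,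
  `honestP5_Sh_transport_obj_complexIso : (X_K ⊗_{F,τ'} τ'(F)) ⊗_{τ'(F)} ℂ ≅ M_K ⊗_{F,ρ} ℂ` whenever `τ' ∘ c = ρ` (base-change transitivity, Görtz–Wedhorn
  Prop. 4.16: tree `baseChangeHomObjIsoOfComp`); at `τ' = ῑ₁` this is `≅ M_K ⊗_{F,ι₁} ℂ` (CM identity `ῑ₁ ∘ c = ι₁`,
  `honestP5_Sh_transport_obj_complexIsoConj`) — the record's own complex fibre, whose points are `Sh_K(ℂ)` on the tautological ball (`RecordSystem.pts`).

What this file does NOT do: it proves no `hUnif`/`hTree`/`hAlb`/`hComp`, constructs no Albanese datum (`Sec42Data.alb` stays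
Liu's / TEAM hComp (A1)), no `V(τ)` for `τ ≠ τ₁`, and consumes no named fact (the record functor is a parameter).  The TOTAL
instance `Model.honestP5Of (h : exists_recordSystem) : ∀ F ι₁ V Φ, PropC5Data F⁺ F` (hcomp-lead S6: uniform fields, the ONLY case
split `4 ≤ [F:ℚ]` inside the functor `M := Model.recordOf h V h4 |>.M`, else a constant functor) is the sequel `HComp/HonestP5Of.lean`
(imports `HComp/RecordCarriers.lean`, `HComp/Levels.lean`); every lemma here applies to it verbatim.  T5: n/a.  HC_CM is NOT proved.

References: Y. Liu, arXiv:2102.11518 = Camb. J. Math. 9 (2021) (`FJcycle.tex` md5 6db49a74122d): App. C l. 4550, §C.1 l. 4575–4599,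
Rem. C.2, Def. C.3–C.4 l. 4614–4624, Prop. C.5 l. 4627–4637, Def. C.6, l. 4656, Def. C.8; §4.2 l. 2053–2066.  P. Deligne, *Variétés de
Shimura* (1979) 2.1.2, 2.2.5.  J. Milne, *Introduction to Shimura varieties* (2005) (21), Thm. 2.14.  U. Görtz–T. Wedhorn, *Algebraic
Geometry I* (2020) Prop. 4.16.  Q. Liu, *Algebraic Geometry and Arithmetic Curves* (2002) Prop. 3.1.23, Ex. 3.1.10, Prop. 4.3.38. -/

noncomputable section

namespace Summit.HodgeConjecture.CorCM.Model

open CategoryTheory CategoryTheory.Limits AlgebraicGeometry NumberField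
open Literature.AlgebraicGeometry.Motives
open Literature.NumberTheory.Automorphic
open Literature.NumberTheory.Automorphic.Liu2021.AppendixC

universe u

/-! ## §0  Index plumbing: `K ↦ K ⊓ K₀` and the transport along the identity -/

namespace HComp

section Index

variable {H : Type} [Group H] [TopologicalSpace H] [IsTopologicalGroup H] (K₀ : C5.OpenCompactSubgroup H)

/-- `K ↦ K ⊓ K₀`: an open compact subgroup restricted below the threshold `K₀` (an intersection of open compact subgroups
is open compact).  Liu indexes `Sh(𝕍)_K` by «sufficiently small open compact subgroups `K`» ([Liu2021] Prop. C.5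
l. 4627–4628, READING R2 of `PropC5.lean`: the `K ⊆ K₀`), while the carrier `PropC5Data.Sh τ τ'` is indexed by ALL open
compact `K` (PropC5.lean :330); this restriction extends a system given below `K₀` to all `K`, with values that are never
used above `K₀`.  Ours (bookkeeping). [cite: Liu2021, Prop. C.5 l. 4627–4628] -/
def restrictLevel (K : C5.OpenCompactSubgroup H) : C5.SmallLevel K₀ :=
  ⟨⟨K.1 ⊓ K₀.1,
    ⟨by simpa only [Subgroup.coe_inf] using K.2.1.inter K₀.2.1,
     by simpa only [Subgroup.coe_inf] using K₀.2.2.inter_left (Subgroup.isClosed_of_isOpen _ K.2.1)⟩⟩,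
   (inf_le_right : K.1 ⊓ K₀.1 ≤ K₀.1)⟩

/-- The underlying subgroup of `restrictLevel K₀ K` is `K ⊓ K₀`. [cite: Liu2021, Prop. C.5 l. 4627–4628] -/
@[simp] theorem restrictLevel_val_val (K : C5.OpenCompactSubgroup H) :
    ((restrictLevel K₀ K).1.1 : Subgroup H) = K.1 ⊓ K₀.1 := rfl

/-- `K ↦ K ⊓ K₀` is monotone. [cite: Liu2021, Prop. C.5 l. 4627–4628] -/
theorem restrictLevel_mono : Monotone (restrictLevel K₀) :=
  fun _ _ h => (inf_le_inf_right K₀.1 h : _ ⊓ K₀.1 ≤ _ ⊓ K₀.1)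

/-- `K ↦ K ⊓ K₀` as a functor from all open compact subgroups (inclusion order) to the sufficiently small ones.
[cite: Liu2021, Prop. C.5 l. 4627–4628] -/
def restrictFunctor : C5.OpenCompactSubgroup H ⥤ C5.SmallLevel K₀ :=
  Monotone.functor (f := restrictLevel K₀) (restrictLevel_mono K₀)

omit [IsTopologicalGroup H] in
/-- Transport along the identity isomorphism `𝔾(𝔸_F^∞) ≃ G(τ)(𝔸^∞) := refl` does not move a level («regard `K` as a subgroup
of `G(τ)(𝔸^∞)`», [Liu2021] l. 4632, when the fixed isomorphism is the identity). [cite: Liu2021, Prop. C.5 l. 4632] -/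
@[simp] theorem val_transport_refl (K : C5.OpenCompactSubgroup H) :
    (C5.OpenCompactSubgroup.transport (ContinuousMulEquiv.refl H) K).1 = K.1 :=
  SetLike.coe_injective (by
    rw [C5.OpenCompactSubgroup.coe_transport, ContinuousMulEquiv.coe_refl, Set.image_id])

/-- In the index preorder `C5.SmallLevel K₀`, two levels with the same underlying subgroup are isomorphic (the preorder is
the inclusion of underlying subgroups). Ours (bookkeeping). [cite: Liu2021, Prop. C.5 l. 4627–4628] -/
def smallLevelIsoOfValEq (K K' : C5.SmallLevel K₀) (h : (K.1.1 : Subgroup H) = K'.1.1) : K ≅ K' where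
  hom := homOfLE (show K.1.1 ≤ K'.1.1 from h.le)
  inv := homOfLE (show K'.1.1 ≤ K.1.1 from h.ge)
  hom_inv_id := Subsingleton.elim _ _
  inv_hom_id := Subsingleton.elim _ _

/-- For `K ≤ K₀`: restricting the identity-transported `K` below `K₀` gives back `K` (up to the unique isomorphism of the
index preorder): `(refl K) ⊓ K₀ = K`. [cite: Liu2021, Prop. C.5 l. 4627–4632] -/
def restrictTransportIso (K : C5.OpenCompactSubgroup H) (hK : K ≤ K₀) :
    restrictLevel K₀ (C5.OpenCompactSubgroup.transport (ContinuousMulEquiv.refl H) K) ≅ (⟨K, hK⟩ : C5.SmallLevel K₀) :=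
  smallLevelIsoOfValEq K₀ _ _ (by
    rw [restrictLevel_val_val, val_transport_refl]
    exact inf_eq_left.2 hK)

/-- Below `K₀`, «transport along the identity, then restrict below `K₀`» is the identity functor of the index preorder, up
to a (unique) natural isomorphism. [cite: Liu2021, Prop. C.5 l. 4627–4632] -/
def transportRestrictIso :
    C5.SmallLevel.transport (ContinuousMulEquiv.refl H) K₀ ⋙ restrictFunctor K₀ ≅ 𝟭 (C5.SmallLevel K₀) :=
  NatIso.ofComponents (fun K => restrictTransportIso K₀ K.1 K.2) (fun _ => Subsingleton.elim _ _)

/-- For `K ≤ K₀`: `K ⊓ K₀ = K` in the index preorder (up to its unique isomorphism). [cite: Liu2021, Prop. C.5 l. 4627–4628] -/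
def restrictIsoOfLe (K : C5.OpenCompactSubgroup H) (hK : K ≤ K₀) :
    restrictLevel K₀ K ≅ (⟨K, hK⟩ : C5.SmallLevel K₀) :=
  smallLevelIsoOfValEq K₀ _ _ (by rw [restrictLevel_val_val]; exact inf_eq_left.2 hK)

end Index

end HComp

open HComp

/-! ## §1  `X_K := M_K ⊗_{F,c} F` (Liu's `X_K = M_K^{(c)}`) -/

section ConjSystem

variable {F : CMField} {ι₁ : F →+* ℂ} (V : HermSpace3 F ι₁)
  (K₀ : C5.OpenCompactSubgroup ↥V.adelicFin) (M : C5.SmallLevel K₀ ⥤ SchemeOver F)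

/-- **`K ↦ X_K := M_K ⊗_{F,c} F`**, the twist of the canonical-model system `M` (of `Sh(Res U(V), h_{V,ῑ₁})`, regarded over
`F` along `ι₁`: x1's `RecordSystem.M`) by the complex conjugation `c` of the CM field `F`.  By [Liu2021] Prop. C.5 the
`E`-scheme `Sh(𝕍)_K` satisfies `Sh(𝕍)_K ⊗_{E,τ'} τ'(E) ≃ Sh(G(τ), h_{V(τ),τ'})_K` for EVERY `τ'` above `τ`; at `τ' = ῑ₁` Deligne's
domain for `h_{V,ῑ₁}` is the TAUTOLOGICAL ball of `V^{ι₁}` ([Liu2021] App. C l. 4583–4596; [Milne2005] (21), Thm. 2.14), i.e.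
`Sh(𝕍)_K ⊗_{E,ῑ₁} ℂ ≃ M_K ⊗_{F,ι₁} ℂ`, which `X_K := M_K ⊗_{F,c} F` achieves on the nose (`ῑ₁ ∘ c = ι₁`, §4).
[cite: Liu2021, Prop. C.5 l. 4627–4633 and App. C l. 4583–4596] [cite: Milne2005ShimuraVarieties, Thm. 2.14] -/
def conjSystem : C5.SmallLevel K₀ ⥤ SchemeOver F :=
  M ⋙ baseChangeHom (cmConjRingHom F)

/-- On objects: `X_K = M_K ⊗_{F,c} F`. [cite: Liu2021, Prop. C.5 l. 4627–4633] -/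
@[simp] theorem conjSystem_obj (K : C5.SmallLevel K₀) :
    (conjSystem V K₀ M).obj K = (baseChangeHom (cmConjRingHom F)).obj (M.obj K) := rfl

end ConjSystem

/-! ## §2  The honest Prop-C.5 datum `honestP5` -/

section P5

variable {F : CMField} {ι₁ : F →+* ℂ} (V : HermSpace3 F ι₁)
  (K₀ : C5.OpenCompactSubgroup ↥V.adelicFin) (M : C5.SmallLevel K₀ ⥤ SchemeOver F)

/-- **The honest Prop-C.5 datum of the tree's hermitian 3-space `V`** (over `F⁺ = maximalRealSubfield F ⊆ F = E`;
[Liu2021] App. C l. 4550, l. 4618–4624), built from a projective system `M : K ↦ M_K` of `F`-schemes on the open compact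
`K ≤ K₀` of `U(V)(𝔸_{F⁺,f})` (x1's canonical-model `RecordSystem …|>.M`), package P2′:
* `n := 3` (rank of `𝕍`; `𝕍 ⊗ 𝔸^∞ ≃ V ⊗_F 𝔸_F^∞`);
* ⟨CARRIER⟩ tokens `𝕍 := Fin 3 → 𝔸_F` (the underlying free `𝔸_F`-module of rank `3` of the totally positive definite incoherent
  space nearby to `V`, Def. C.3 — its form is not carried by a `Type`) and `V τ := Fin 3 → F` (the underlying `F`-space of the
  nearby space `V(τ)`, Def. C.4 / l. 4624; for `τ = τ₁` it is `V` itself, for `τ ≠ τ₁` the form — signature `(2,1)` at `τ` — is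
  NOT constructed here: honest by unconsumption, checklist U2-5);
* `G := Gτ τ := ↥V.adelicFin = U(V)(𝔸_{F⁺,f})` for every `τ` and `fix τ := ContinuousMulEquiv.refl` (l. 4624 «We fix an
  isomorphism `𝔾(𝔸_F^∞) ≃ G(τ)(𝔸^∞)`»: all these groups are isomorphic to `U(V)(𝔸_{F⁺,f})`; we fix identities — U2-4);
* `Sh τ τ' := (K ↦ X_{K ⊓ K₀} ⊗_{F,τ'} τ'(F))`, ONE formula for all `(τ, τ')` (U2-1), functorial in `K` through `M`; by Prop. C.5
  the slot `(τ, τ')` is `Sh(G(τ), h_{V(τ),τ'})_K ≃ Sh(𝕍)_K ⊗_{E,τ'} τ'(E)`, and `X_K := M_K ⊗_{F,c} F` makes the consumed slot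
  `(τ₁, ῑ₁)` the record (`honestP5_Sh_transport_obj_complexIsoConj`); the other slots are constructed but not certified here (W-τ honesty, U2-5/U2-7).
Nothing is asserted: `PropC5Data` is a carrier structure. [cite: Liu2021, App. C l. 4550, l. 4618–4624, Prop. C.5 l. 4627–4633] -/
abbrev honestP5 : PropC5Data (maximalRealSubfield F) F where
  n := 3
  one_le_n := by norm_num
  𝕍 := Fin 3 → IsDedekindDomain.FiniteAdeleRing (𝓞 F) F
  G := ↥V.adelicFin
  V := fun _ => Fin 3 → F
  Gτ := fun _ => ↥V.adelicFin
  fix := fun _ => ContinuousMulEquiv.refl _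
  Sh := fun _ τ' => restrictFunctor K₀ ⋙ conjSystem V K₀ M ⋙ C5.baseChangeAlong τ'.rangeRestrictField

/-- `honestP5.n = 3`. [cite: Liu2021, App. C l. 4618] -/
@[simp] theorem honestP5_n : (honestP5 V K₀ M).n = 3 := rfl

/-- The fixed isomorphism of `honestP5` is the identity. [cite: Liu2021, App. C l. 4624] -/
@[simp] theorem honestP5_fix (τ : maximalRealSubfield F →+* ℝ) :
    (honestP5 V K₀ M).fix τ = ContinuousMulEquiv.refl _ := rfl

/-- The Shimura-variety slots of `honestP5`: `K ↦ X_{K ⊓ K₀} ⊗_{F,τ'} τ'(F)`. [cite: Liu2021, Prop. C.5 l. 4627–4633] -/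
theorem honestP5_Sh (τ : maximalRealSubfield F →+* ℝ) (τ' : F →+* ℂ) :
    (honestP5 V K₀ M).Sh τ τ' = restrictFunctor K₀ ⋙ conjSystem V K₀ M ⋙ C5.baseChangeAlong τ'.rangeRestrictField := rfl

/-- The Shimura-variety slots of `honestP5` on objects. [cite: Liu2021, Prop. C.5 l. 4627–4633] -/
@[simp] theorem honestP5_Sh_obj (τ : maximalRealSubfield F →+* ℝ) (τ' : F →+* ℂ)
    (K : C5.OpenCompactSubgroup ↥V.adelicFin) :
    ((honestP5 V K₀ M).Sh τ τ').obj K =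
      (C5.baseChangeAlong τ'.rangeRestrictField).obj
        ((baseChangeHom (cmConjRingHom F)).obj (M.obj (restrictLevel K₀ K))) := rfl

end P5

/-! ## §3  Prop. C.5 CONSTRUCTED on `honestP5`, and the compactified system -/

section System

variable {F : CMField} {ι₁ : F →+* ℂ} (V : HermSpace3 F ι₁)
  (K₀ : C5.OpenCompactSubgroup ↥V.adelicFin) (M : C5.SmallLevel K₀ ⥤ SchemeOver F)

/-- **The system of Shimura varieties associated to `𝕍` (Def. C.6) on `honestP5`, with Prop. C.5's isomorphisms
CONSTRUCTED**: threshold `K₀` (U2-6), `Sh(𝕍)_K := X_K = M_K ⊗_{F,c} F`, and for every real `τ` and every `τ'` above it the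
isomorphism of projective systems `{X_K ⊗_{F,τ'} τ'(F)}_K ≅ {honestP5.Sh τ τ' (fix τ K)}_K = {X_{refl(K) ⊓ K₀} ⊗_{F,τ'} τ'(F)}_K`
given by the index isomorphism `refl(K) ⊓ K₀ = K` of §0 (whiskered; levelwise it is `X`'s transition isomorphism along
`K = refl(K) ⊓ K₀`, the identity of `X_K ⊗_{F,τ'} τ'(F)` up to that re-indexing).  So pin-1's `(C …).S` can be this system:
«Prop. C.5 constructed, not posited» (checklist U2-3).  [cite: Liu2021, Prop. C.5 l. 4627–4633 and Def. C.6 l. 4640–4642] -/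
abbrev honestSystem : IncoherentShimuraSystem (honestP5 V K₀ M) where
  K₀ := K₀
  Sh𝕍 := conjSystem V K₀ M
  iso _ τ' _ :=
    (Functor.leftUnitor (conjSystem V K₀ M ⋙ C5.baseChangeAlong τ'.rangeRestrictField)).symm ≪≫
      Functor.isoWhiskerRight (transportRestrictIso K₀).symm (conjSystem V K₀ M ⋙ C5.baseChangeAlong τ'.rangeRestrictField) ≪≫
      Functor.associator _ _ _

/-- The threshold of `honestSystem` is `K₀`. [cite: Liu2021, Prop. C.5 l. 4627–4628] -/
@[simp] theorem honestSystem_K₀ : (honestSystem V K₀ M).K₀ = K₀ := rfl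

/-- `honestSystem.Sh𝕍 = (K ↦ X_K)`. [cite: Liu2021, Def. C.6 l. 4640–4642] -/
@[simp] theorem honestSystem_Sh𝕍 : (honestSystem V K₀ M).Sh𝕍 = conjSystem V K₀ M := rfl

/-- The levelwise component of the constructed Prop.-C.5 isomorphism is the re-indexing isomorphism `K = refl(K) ⊓ K₀`
pushed through `X_· ⊗_{F,τ'} τ'(F)`. [cite: Liu2021, Prop. C.5 l. 4627–4633] -/
theorem honestSystem_iso_hom_app (τ : maximalRealSubfield F →+* ℝ) (τ' : F →+* ℂ) (hτ : C5.IsAbove τ τ')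
    (K : C5.SmallLevel K₀) :
    ((honestSystem V K₀ M).iso τ τ' hτ).hom.app K =
      (conjSystem V K₀ M ⋙ C5.baseChangeAlong τ'.rangeRestrictField).map (restrictTransportIso K₀ K.1 K.2).inv := by
  simp [honestSystem, transportRestrictIso, Functor.isoWhiskerRight]
  exact (Category.id_comp _).trans (Category.comp_id _)

/-- **Prop. C.5 holds for `honestP5`, by construction.** [cite: Liu2021, Prop. C.5 l. 4627–4633] -/
theorem propC5AsPrinted_honestP5 : PropC5AsPrinted (honestP5 V K₀ M) :=
  (propC5AsPrinted_iff _).2 ⟨honestSystem V K₀ M⟩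

/-- Smoothness of relative dimension `2` of `X_K = M_K ⊗_{F,c} F` from that of `M_K` (base change; Liu 2002 Prop. 4.3.38,
Mathlib `smoothOfRelativeDimension_isStableUnderBaseChange`). [cite: Liu2002, Prop. 4.3.38] -/
theorem smooth_conjSystem_obj (hsm : ∀ K, SmoothOfRelativeDimension 2 (M.obj K).hom) (K : C5.SmallLevel K₀) :
    SmoothOfRelativeDimension 2 ((conjSystem V K₀ M).obj K).hom := by
  have := smoothOfRelativeDimension_isStableUnderBaseChange 2
  exact MorphismProperty.pullback_snd (P := @SmoothOfRelativeDimension 2) _ _ (hsm K)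

/-- Projectivity of `X_K = M_K ⊗_{F,c} F` from that of `M_K` (base change of a closed immersion into `ℙⁿ`; Liu 2002
Prop. 3.1.23 / Ex. 3.1.10, tree `IsProjectiveOver.baseChange_obj`). [cite: Liu2002, Prop. 3.1.23 and Ex. 3.1.10] -/
theorem projective_conjSystem_obj (hpr : ∀ K, IsProjectiveOver (M.obj K)) (K : C5.SmallLevel K₀) :
    IsProjectiveOver ((conjSystem V K₀ M).obj K) :=
  letI : Algebra F F := (cmConjRingHom F).toAlgebra
  (hpr K).baseChange_obj F

end System

/-! ## §4  The levelwise reading for pin-1's (U5): the consumed slot is the record -/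

section Levelwise

variable {F : CMField} {ι₁ : F →+* ℂ} (V : HermSpace3 F ι₁)
  (K₀ : C5.OpenCompactSubgroup ↥V.adelicFin) (M : C5.SmallLevel K₀ ⥤ SchemeOver F)

/-- **Levelwise: `honestP5.Sh τ τ'` at a transported level `K ≤ K₀` is `X_K ⊗_{F,τ'} τ'(F)`** (the re-indexing isomorphism
`refl(K) ⊓ K₀ = K` pushed through `X_· ⊗_{F,τ'} τ'(F)`).  This is the object pin-1's binders `hUnif`/`hTree` quantify over
(`((P5 …).Sh τ (e F ι₁)).obj (C5.OpenCompactSubgroup.transport ((P5 …).fix τ) K)`, `Item6PinReachAlong.lean` v2 :302–311).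
[cite: Liu2021, Prop. C.5 l. 4627–4633] -/
def honestP5_Sh_transport_obj_iso (τ : maximalRealSubfield F →+* ℝ) (τ' : F →+* ℂ) (K : C5.OpenCompactSubgroup ↥V.adelicFin) (hK : K ≤ K₀) :
    ((honestP5 V K₀ M).Sh τ τ').obj (C5.OpenCompactSubgroup.transport ((honestP5 V K₀ M).fix τ) K) ≅
      (C5.baseChangeAlong τ'.rangeRestrictField).obj ((baseChangeHom (cmConjRingHom F)).obj (M.obj ⟨K, hK⟩)) :=
  (conjSystem V K₀ M ⋙ C5.baseChangeAlong τ'.rangeRestrictField).mapIso (restrictTransportIso K₀ K hK)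

/-- **Levelwise, untransported form: `honestP5.Sh τ τ'` at `K ≤ K₀` is `X_K ⊗_{F,τ'} τ'(F)`** (`K ⊓ K₀ = K` pushed through
`X_· ⊗_{F,τ'} τ'(F)`); with `transport (refl) K = K` (hcomp-level's `C5.OpenCompactSubgroup.transport_refl`, `HComp/Levels.lean`; here: `HComp.val_transport_refl`)
this is the same object as in `honestP5_Sh_transport_obj_iso`.
[cite: Liu2021, Prop. C.5 l. 4627–4633] -/
def honestP5_Sh_obj_iso (τ : maximalRealSubfield F →+* ℝ) (τ' : F →+* ℂ) (K : C5.OpenCompactSubgroup ↥V.adelicFin)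
    (hK : K ≤ K₀) :
    ((honestP5 V K₀ M).Sh τ τ').obj K ≅
      (C5.baseChangeAlong τ'.rangeRestrictField).obj ((baseChangeHom (cmConjRingHom F)).obj (M.obj ⟨K, hK⟩)) :=
  (conjSystem V K₀ M ⋙ C5.baseChangeAlong τ'.rangeRestrictField).mapIso (restrictIsoOfLe K₀ K hK)

/-- **Over `ℂ`: the slot `(τ, τ')` of `honestP5` at `K ≤ K₀` is `M_K ⊗_{F,ρ} ℂ` whenever `τ' ∘ c = ρ`** — base-change
transitivity `((M_K ⊗_c F) ⊗_{τ'} τ'(F)) ⊗ ℂ ≅ M_K ⊗_{τ' ∘ c} ℂ` (Görtz–Wedhorn Prop. 4.16, tree `baseChangeHomObjIsoOfComp`).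
[cite: GortzWedhorn2020, Prop. 4.16 and §(4.7)] [cite: Liu2021, Prop. C.5 l. 4630] -/
def honestP5_Sh_transport_obj_complexIso (τ : maximalRealSubfield F →+* ℝ) (τ' : F →+* ℂ) (K : C5.OpenCompactSubgroup ↥V.adelicFin)
    (hK : K ≤ K₀) (ρ : F →+* ℂ) (h : τ'.comp (cmConjRingHom F) = ρ) :
    (baseChangeHom τ'.fieldRange.subtype).obj
        (((honestP5 V K₀ M).Sh τ τ').obj (C5.OpenCompactSubgroup.transport ((honestP5 V K₀ M).fix τ) K)) ≅
      (baseChangeHom ρ).obj (M.obj ⟨K, hK⟩) :=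
  (baseChangeHom τ'.fieldRange.subtype).mapIso (honestP5_Sh_transport_obj_iso V K₀ M τ τ' K hK) ≪≫
    baseChangeHomObjIsoOfComp τ'.rangeRestrictField τ'.fieldRange.subtype τ'
      (RingHom.ext fun _ => rfl : (τ'.fieldRange.subtype).comp τ'.rangeRestrictField = τ') _ ≪≫
    baseChangeHomObjIsoOfComp (cmConjRingHom F) τ' ρ h (M.obj ⟨K, hK⟩)

/-- **Package P2′, the consumed slot: over `ℂ`, `honestP5.Sh τ ῑ₁` at `K ≤ K₀` is the record's own complex fibre
`M_K ⊗_{F,ι₁} ℂ`** (whose complex points are `Sh_K(ℂ)` on the tautological ball of `V^{ι₁}`, x1's `RecordSystem.pts`;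
natural levels live HERE and only here, checklist U2-2 / U2-7).  The input of pin-1's `hTree` at `e ι₁ := conj ∘ ι₁`.
[cite: Liu2021, Prop. C.5 l. 4627–4633 and App. C l. 4583–4596] [cite: GortzWedhorn2020, Prop. 4.16] -/
def honestP5_Sh_transport_obj_complexIsoConj (τ : maximalRealSubfield F →+* ℝ) (K : C5.OpenCompactSubgroup ↥V.adelicFin) (hK : K ≤ K₀) :
    (baseChangeHom ((starRingEnd ℂ).comp ι₁).fieldRange.subtype).obj
        (((honestP5 V K₀ M).Sh τ ((starRingEnd ℂ).comp ι₁)).obj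
          (C5.OpenCompactSubgroup.transport ((honestP5 V K₀ M).fix τ) K)) ≅
      (baseChangeHom ι₁).obj (M.obj ⟨K, hK⟩) :=
  honestP5_Sh_transport_obj_complexIso V K₀ M τ _ K hK ι₁ (by ext x; simp [embedding_cmConjRingHom])

end Levelwise

/-! ## §5  From a cofan of the record's complex fibre to pin-1's `hTree` slot (package P2′) -/

section TreeCofan

variable {F : CMField} {ι₁ : F →+* ℂ} (V : HermSpace3 F ι₁)
  (K₀ : C5.OpenCompactSubgroup ↥V.adelicFin) (M : C5.SmallLevel K₀ ⥤ SchemeOver F)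

/-- The threshold `K₀` is open compact in `honestP5.G = U(V)(𝔸_{F⁺,f})`: pin-1's `Ksm := K₀` («sufficiently small», [Liu2021]
Prop. C.5 l. 4627–4628 / Thm. 4.18 (1) l. 2239; checklist U2-6). [cite: Liu2021, Prop. C.5 l. 4627–4628] -/
theorem honestP5_isOpenCompact_K₀ : Liu2021.IsOpenCompact (K₀.1 : Subgroup (honestP5 V K₀ M).G) := K₀.2

/-- Transport of a coproduct decomposition along an isomorphism of the vertex (bookkeeping; Mathlib `Cofan.ext`,
`IsColimit.ofIsoColimit`). [folklore] -/
theorem HComp.exists_isColimit_cofan_of_iso {C : Type*} [Category C] {ι : Type*} (P : ι → C) {X Y : C} (e : X ≅ Y)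
    (inj : ∀ c, P c ⟶ X) (hcol : IsColimit (Cofan.mk X inj)) :
    ∃ inj' : ∀ c, P c ⟶ Y, Nonempty (IsColimit (Cofan.mk Y inj')) :=
  ⟨fun c => inj c ≫ e.hom, ⟨hcol.ofIsoColimit (Cofan.ext e (fun _ => rfl))⟩⟩

/-- **Record cofan ⇒ `hTree` slot.**  A finite coproduct decomposition `∐_c P_c ≅ M_K ⊗_{F,ι₁} ℂ` of the record's complex fibre
at a level `K ≤ K₀` (e.g. by the tree's ball quotients `P_{Γ_q}(V)`, natural levels `Γ_q = U(V)(F⁺) ∩ g_q K g_q⁻¹`, [Deligne1979]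
2.1.2 — x1's record / mc-binder-2's `Deligne1979.exists_components_homeomorph_ballQuotient`) IS a coproduct decomposition of
`honestP5`'s consumed slot `(τ, ῑ₁)` base-changed to `ℂ`, transported along `honestP5_Sh_transport_obj_complexIsoConj` — the exact shape of pin-1's
binder `hTree` at `P5 := honestP5`, `e ι₁ := conj ∘ ι₁` (`Item6PinReachAlong.lean` v2 :302–311), for ANY pieces `P_c`.  Ours
(bookkeeping). [cite: Liu2021, Prop. C.5 l. 4627–4633] [cite: Deligne1979ShimuraVarieties, 2.1.2] -/
theorem honestP5_exists_isColimit_cofan_of_record (τ : maximalRealSubfield F →+* ℝ) (K : C5.OpenCompactSubgroup ↥V.adelicFin)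
    (hK : K ≤ K₀) {Cset : Type} (P : Cset → SchemeOver ℂ) (inj : ∀ c, P c ⟶ (baseChangeHom ι₁).obj (M.obj ⟨K, hK⟩))
    (hcol : IsColimit (Cofan.mk _ inj)) :
    ∃ inj' : ∀ c, P c ⟶ (baseChangeHom ((starRingEnd ℂ).comp ι₁).fieldRange.subtype).obj
        (((honestP5 V K₀ M).Sh τ ((starRingEnd ℂ).comp ι₁)).obj
          (C5.OpenCompactSubgroup.transport ((honestP5 V K₀ M).fix τ) K)),
      Nonempty (IsColimit (Cofan.mk _ inj')) :=
  HComp.exists_isColimit_cofan_of_iso P (honestP5_Sh_transport_obj_complexIsoConj V K₀ M τ K hK).symm inj hcol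

end TreeCofan

end Summit.HodgeConjecture.CorCM.Model
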